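import Summits.QuantumFields.YangMills.Theorems.BalabanUVNodesN15KingModelAxisTransferContraction

/-!
# BalabanUVNodes ∕ N15 — THE KING-MODEL RUNG (PART Ϸ-o): LOG-CONVEXITY OF `t ↦ S₂^{ℝ}(te_ν)` AND THE LATTICE EFFECTIVE MASS
# `m_eff(t) = log(S₂^{ℝ}(te_ν)∕S₂^{ℝ}((t+1)e_ν))` DECREASES MONOTONICALLY TO THE MASS: `m_eff(t) ≥ m`, `m_eff(t+1) ≤ m_eff(t)`, `m_eff(t) → m` (Track A, DAG node
# N15 = NE2; FAN-OUT v1.1 §N15 s3 «KING-MODEL RUNG»; parts Ϸ-j∕m assembled into the practitioners' effective-mass statement; count-neutral)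

HONEST FRAMING.  Count-neutral (cell `pub-ymgap`, seat `pub-ymgap-dag-n15-e` g34; `--supports stmt-QuantumFields-27366 --as helper` = K3⁸
`SpineGivenEndpointR13SepCoPHV`).  King's `A = 0`, `g = 0` model ([King1986] C. King, Commun. Math. Phys. **102** (1986) 649–677; `S₂^{ℝ}` = the infinite-volume
two-point function of the unit-block averages of the continuum free field of mass `m = √m²`, (4.5) p.670, (4.36) p.674, Thm 3.3 (3.6) p.655).  With part Ϸ-j's axis
representation `S(t) := S₂^{ℝ}(te_ν) = (2π)^{−(d+1)}∫A(q)e^{−M_q t}dq` (`t ≥ 1`, `A ≥ 0`, `M_q ≥ m`): (i) LOG-CONVEXITY `S(t+1)² ≤ S(t)S(t+2)` — write both sides as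
double integrals (`(∫f)(∫g) = ∫∫f⊗g`) and use `a^t b^{t+2} + a^{t+2}b^t − 2a^{t+1}b^{t+1} = a^t b^t(a − b)² ≥ 0` pointwise (`a = e^{−M_x}`, `b = e^{−M_y}`); (ii) with part Ϸ-m's
contraction and part Ϸ-j's positivity, the LATTICE EFFECTIVE MASS `m_eff(t) = log(S(t)∕S(t+1))` satisfies `m_eff(t) ≥ m` and `m_eff(t+1) ≤ m_eff(t)`; (iii) hence it
converges, and its limit is `m`: a limit `L > m` would force `S(t) ≤ S(1)e^{−L(t−1)}`, contradicting part Ϸ-j's `lim S(t)^{1∕t} = e^{−m}`.  NOT a node discharge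
(N15 is booked through n15-a's knit, untouched here); nothing Bałaban ∕ continuum-Yang–Mills ∕ `ℝ⁴` ∕ OS ∕ Clay.  0 `sorry`, 0 def; standard axioms.

WHAT THIS FILE PROVES (kernel).  §1 `kingS2Inf_single_eq_natCast` (axis formula for `t : ℕ`), `exp_amgm_sq` (the pointwise square), `integrable_axisWeight_nat`,
★★★ **`kingS2Inf_single_logConvex`** (`S(t+1)² ≤ S(t)S(t+2)`, `t ≥ 1`).  §2 ★★ `le_log_kingS2Inf_ratio` (`m ≤ m_eff(t)`), ★★ `log_kingS2Inf_ratio_antitone`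
(`m_eff(t+1) ≤ m_eff(t)`), `kingS2Inf_single_le_exp_of_ratio` (a uniform ratio bound `S(s+1) ≤ e^{−L}S(s)` forces `S(t) ≤ e^{−L(t−1)}S(1)`), ★★★
**`tendsto_log_kingS2Inf_ratio`** (`m_eff(t) → √m²`).

HONEST SCOPE.  King's free model, `K = ∞`, infinite volume, lattice axes, integer `t ≥ 1`.  N15 untouched; counts unmoved.  Locators (use): [King1986] (4.5) p.670,
(4.36) p.674, Thm 3.3 (3.6) p.655, Thm 2.1 (2.22) p.654.
-/

noncomputable section

open scoped BigOperators Topology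
open Filter MeasureTheory Set

namespace Summit.QuantumFields.YangMills.BalabanUVNodes.N15KingModelRung.OptimalDecay

variable {d : ℕ}

/-! ## §1 Log-convexity -/

/-- The axis formula for natural `t ≥ 1` with `|t|` evaluated: `S(t) = (2π)^{−(d+1)}∫P(q)·2π(cosh M_q − 1)M_q⁻³e^{−M_q t}dq`. [cite: King1986, (4.5) p.670] -/
theorem kingS2Inf_single_eq_natCast {m2 : ℝ} (hm : 0 < m2) (ν : Fin (d + 1)) {t : ℕ} (ht : 1 ≤ t) :
    kingS2Inf m2 (Pi.single ν ((t : ℕ) : ℤ)) = ((2 * Real.pi) ^ (d + 1))⁻¹ * ∫ q : Fin d → ℝ, (∏ j, Real.sinc (q j / 2) ^ 2)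
          * (2 * Real.pi * (Real.cosh (Real.sqrt ((∑ j, q j ^ 2) + m2)) - 1) / Real.sqrt ((∑ j, q j ^ 2) + m2) ^ 3
              * Real.exp (-(Real.sqrt ((∑ j, q j ^ 2) + m2) * (t : ℝ)))) := by
  rw [kingS2Inf_single_eq hm ν (one_le_abs_natCast ht)]
  simp only [Int.cast_natCast, Nat.abs_cast]

/-- The axial weight at natural `t` is integrable (`t ≥ 1`). [folklore] -/
theorem integrable_axisWeight_nat {m2 : ℝ} (hm : 0 < m2) {t : ℕ} (ht : 1 ≤ t) :
    Integrable fun q : Fin d → ℝ => (∏ j, Real.sinc (q j / 2) ^ 2)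
          * (2 * Real.pi * (Real.cosh (Real.sqrt ((∑ j, q j ^ 2) + m2)) - 1) / Real.sqrt ((∑ j, q j ^ 2) + m2) ^ 3
              * Real.exp (-(Real.sqrt ((∑ j, q j ^ 2) + m2) * (t : ℝ)))) := by
  have h := integrable_axisWeight (d := d) hm (one_le_abs_natCast ht)
  simp only [Int.cast_natCast, Nat.abs_cast] at h
  exact h

/-- The pointwise square: `e^{−xt}e^{−y(t+2)} + e^{−x(t+2)}e^{−yt} − 2e^{−x(t+1)}e^{−y(t+1)} = e^{−xt}e^{−yt}(e^{−x} − e^{−y})² ≥ 0`. [folklore] -/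
theorem exp_amgm_sq (x y : ℝ) (t : ℕ) :
    2 * (Real.exp (-(x * ((t + 1 : ℕ) : ℝ))) * Real.exp (-(y * ((t + 1 : ℕ) : ℝ))))
      ≤ Real.exp (-(x * (t : ℝ))) * Real.exp (-(y * ((t + 2 : ℕ) : ℝ))) + Real.exp (-(x * ((t + 2 : ℕ) : ℝ))) * Real.exp (-(y * (t : ℝ))) := by
  have ex : ∀ s : ℕ, Real.exp (-(x * (s : ℝ))) = Real.exp (-x) ^ s := fun s => by rw [← Real.exp_nat_mul]; ring_nf
  have ey : ∀ s : ℕ, Real.exp (-(y * (s : ℝ))) = Real.exp (-y) ^ s := fun s => by rw [← Real.exp_nat_mul]; ring_nf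
  rw [ex, ex, ex, ey, ey, ey]
  set a := Real.exp (-x)
  set b := Real.exp (-y)
  have key : a ^ t * b ^ (t + 2) + a ^ (t + 2) * b ^ t - 2 * (a ^ (t + 1) * b ^ (t + 1)) = a ^ t * b ^ t * (a - b) ^ 2 := by ring
  have hnn : 0 ≤ a ^ t * b ^ t * (a - b) ^ 2 := by positivity
  linarith

/-- ★★★ **LOG-CONVEXITY OF THE AXIAL TWO-POINT FUNCTION**: `S₂^{ℝ}((t+1)e_ν)² ≤ S₂^{ℝ}(te_ν)·S₂^{ℝ}((t+2)e_ν)` for every `t ≥ 1` (double-integral form of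
`(∫f)(∫g)`, pointwise square). [cite: King1986, (4.5) p.670, Thm 3.3 (3.6) p.655] -/
theorem kingS2Inf_single_logConvex {m2 : ℝ} (hm : 0 < m2) (ν : Fin (d + 1)) {t : ℕ} (ht : 1 ≤ t) :
    kingS2Inf m2 (Pi.single ν (((t + 1 : ℕ)) : ℤ)) ^ 2 ≤ kingS2Inf m2 (Pi.single ν ((t : ℕ) : ℤ)) * kingS2Inf m2 (Pi.single ν (((t + 2 : ℕ)) : ℤ)) := by
  -- the `t`-free amplitude and the three integrands
  set A : (Fin d → ℝ) → ℝ := fun q => (∏ j, Real.sinc (q j / 2) ^ 2)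
      * (2 * Real.pi * (Real.cosh (Real.sqrt ((∑ j, q j ^ 2) + m2)) - 1) / Real.sqrt ((∑ j, q j ^ 2) + m2) ^ 3) with hA
  set M : (Fin d → ℝ) → ℝ := fun q => Real.sqrt ((∑ j, q j ^ 2) + m2) with hM
  set F : ℕ → (Fin d → ℝ) → ℝ := fun s q => A q * Real.exp (-(M q * (s : ℝ))) with hF
  have hFeq : ∀ s : ℕ, (fun q : Fin d → ℝ => (∏ j, Real.sinc (q j / 2) ^ 2)
      * (2 * Real.pi * (Real.cosh (Real.sqrt ((∑ j, q j ^ 2) + m2)) - 1) / Real.sqrt ((∑ j, q j ^ 2) + m2) ^ 3 * Real.exp (-(Real.sqrt ((∑ j, q j ^ 2) + m2) * (s : ℝ)))))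
      = F s := fun s => by
    funext q
    simp only [hF, hA, hM]
    ring
  have hS : ∀ s : ℕ, 1 ≤ s → kingS2Inf m2 (Pi.single ν ((s : ℕ) : ℤ)) = ((2 * Real.pi) ^ (d + 1))⁻¹ * ∫ q, F s q := fun s hs => by
    rw [kingS2Inf_single_eq_natCast hm ν hs, hFeq]
  have hFi : ∀ s : ℕ, 1 ≤ s → Integrable (F s) := fun s hs => by
    rw [← hFeq]
    exact integrable_axisWeight_nat hm hs
  have hA0 : ∀ q, 0 ≤ A q := fun q => by
    have hc : 0 ≤ Real.cosh (Real.sqrt ((∑ j, q j ^ 2) + m2)) - 1 := by linarith [Real.one_le_cosh (Real.sqrt ((∑ j, q j ^ 2) + m2))]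
    have hP : 0 ≤ ∏ j, Real.sinc (q j / 2) ^ 2 := Finset.prod_nonneg fun j _ => sq_nonneg _
    simp only [hA]
    positivity
  have h1 : 1 ≤ t + 1 := by omega
  have h2 : 1 ≤ t + 2 := by omega
  rw [hS t ht, hS (t + 1) h1, hS (t + 2) h2]
  -- double-integral forms
  have hprod : ∀ a b : ℕ, 1 ≤ a → 1 ≤ b →
      (∫ q, F a q) * (∫ q, F b q) = ∫ z : (Fin d → ℝ) × (Fin d → ℝ), F a z.1 * F b z.2 ∂(volume.prod volume) := fun a b _ _ => (integral_prod_mul (F a) (F b)).symm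
  have hint : ∀ a b : ℕ, 1 ≤ a → 1 ≤ b → Integrable (fun z : (Fin d → ℝ) × (Fin d → ℝ) => F a z.1 * F b z.2) (volume.prod volume) :=
    fun a b ha hb => (hFi a ha).mul_prod (hFi b hb)
  have key : 2 * ((∫ q, F (t + 1) q) * (∫ q, F (t + 1) q)) ≤ 2 * ((∫ q, F t q) * (∫ q, F (t + 2) q)) := by
    have e2 : 2 * ((∫ q, F t q) * (∫ q, F (t + 2) q)) = (∫ q, F t q) * (∫ q, F (t + 2) q) + (∫ q, F (t + 2) q) * (∫ q, F t q) := by ring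
    rw [e2, hprod _ _ h1 h1, hprod _ _ ht h2, hprod _ _ h2 ht, ← integral_const_mul, ← integral_add (hint _ _ ht h2) (hint _ _ h2 ht)]
    refine integral_mono ((hint _ _ h1 h1).const_mul 2) ((hint _ _ ht h2).add (hint _ _ h2 ht)) fun z => ?_
    simp only [hF]
    have hAA : 0 ≤ A z.1 * A z.2 := mul_nonneg (hA0 _) (hA0 _)
    have h := mul_le_mul_of_nonneg_left (exp_amgm_sq (M z.1) (M z.2) t) hAA
    calc 2 * (A z.1 * Real.exp (-(M z.1 * ((t + 1 : ℕ) : ℝ))) * (A z.2 * Real.exp (-(M z.2 * ((t + 1 : ℕ) : ℝ)))))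
        = A z.1 * A z.2 * (2 * (Real.exp (-(M z.1 * ((t + 1 : ℕ) : ℝ))) * Real.exp (-(M z.2 * ((t + 1 : ℕ) : ℝ))))) := by ring
      _ ≤ A z.1 * A z.2 * (Real.exp (-(M z.1 * (t : ℝ))) * Real.exp (-(M z.2 * ((t + 2 : ℕ) : ℝ)))
            + Real.exp (-(M z.1 * ((t + 2 : ℕ) : ℝ))) * Real.exp (-(M z.2 * (t : ℝ)))) := h
      _ = _ := by ring
  have hK : 0 ≤ (((2 * Real.pi) ^ (d + 1))⁻¹) ^ 2 := sq_nonneg _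
  calc (((2 * Real.pi) ^ (d + 1))⁻¹ * ∫ q, F (t + 1) q) ^ 2 = (((2 * Real.pi) ^ (d + 1))⁻¹) ^ 2 * ((∫ q, F (t + 1) q) * (∫ q, F (t + 1) q)) := by ring
    _ ≤ (((2 * Real.pi) ^ (d + 1))⁻¹) ^ 2 * ((∫ q, F t q) * (∫ q, F (t + 2) q)) := mul_le_mul_of_nonneg_left (by linarith) hK
    _ = _ := by ring

/-! ## §2 The lattice effective mass -/

/-- ★★ `m ≤ m_eff(t)`: `√m² ≤ log(S₂^{ℝ}(te_ν)∕S₂^{ℝ}((t+1)e_ν))` for `t ≥ 1` (part Ϸ-m's contraction). [cite: King1986, Thm 3.3 (3.6) p.655] -/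
theorem le_log_kingS2Inf_ratio {m2 : ℝ} (hm : 0 < m2) (ν : Fin (d + 1)) {t : ℕ} (ht : 1 ≤ t) :
    Real.sqrt m2 ≤ Real.log (kingS2Inf m2 (Pi.single ν ((t : ℕ) : ℤ)) / kingS2Inf m2 (Pi.single ν (((t + 1 : ℕ)) : ℤ))) := by
  have h0 := kingS2Inf_single_pos hm ν (one_le_abs_natCast ht)
  have h1 := kingS2Inf_single_pos hm ν (one_le_abs_natCast (Nat.le_succ_of_le ht))
  have hc := kingS2Inf_single_succ_le hm ν ht
  rw [Real.le_log_iff_exp_le (div_pos h0 h1), le_div_iff₀ h1]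
  have := mul_le_mul_of_nonneg_left hc (Real.exp_pos (Real.sqrt m2)).le
  rw [← mul_assoc, ← Real.exp_add, add_neg_cancel, Real.exp_zero, one_mul] at this
  exact this

/-- ★★ **The effective mass decreases**: `m_eff(t+1) ≤ m_eff(t)` for `t ≥ 1` (log-convexity). [cite: King1986, Thm 3.3 (3.6) p.655] -/
theorem log_kingS2Inf_ratio_antitone {m2 : ℝ} (hm : 0 < m2) (ν : Fin (d + 1)) {t : ℕ} (ht : 1 ≤ t) :
    Real.log (kingS2Inf m2 (Pi.single ν (((t + 1 : ℕ)) : ℤ)) / kingS2Inf m2 (Pi.single ν (((t + 2 : ℕ)) : ℤ)))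
      ≤ Real.log (kingS2Inf m2 (Pi.single ν ((t : ℕ) : ℤ)) / kingS2Inf m2 (Pi.single ν (((t + 1 : ℕ)) : ℤ))) := by
  have h0 := kingS2Inf_single_pos hm ν (one_le_abs_natCast ht)
  have h1 := kingS2Inf_single_pos hm ν (one_le_abs_natCast (show 1 ≤ t + 1 by omega))
  have h2 := kingS2Inf_single_pos hm ν (one_le_abs_natCast (show 1 ≤ t + 2 by omega))
  rw [Real.log_le_log_iff (div_pos h1 h2) (div_pos h0 h1), div_le_div_iff₀ h2 h1]
  have := kingS2Inf_single_logConvex hm ν ht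
  nlinarith

/-- A uniform ratio bound forces a uniform rate: if `S((s+2)e_ν) ≤ e^{−L}S((s+1)e_ν)` for all `s`, then `S(te_ν) ≤ e^{−L(t−1)}S(e_ν)` for all `t ≥ 1`. [folklore] -/
theorem kingS2Inf_single_le_exp_of_ratio {m2 L : ℝ} (ν : Fin (d + 1))
    (h : ∀ s : ℕ, kingS2Inf m2 (Pi.single ν (((s + 2 : ℕ)) : ℤ)) ≤ Real.exp (-L) * kingS2Inf m2 (Pi.single ν (((s + 1 : ℕ)) : ℤ))) {t : ℕ} (ht : 1 ≤ t) :
    kingS2Inf m2 (Pi.single ν ((t : ℕ) : ℤ)) ≤ Real.exp (-(L * ((t : ℝ) - 1))) * kingS2Inf m2 (Pi.single ν ((1 : ℕ) : ℤ)) := by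
  induction t, ht using Nat.le_induction with
  | base => simp
  | succ n hn ih =>
      obtain ⟨k, rfl⟩ : ∃ k, n = k + 1 := ⟨n - 1, by omega⟩
      calc kingS2Inf m2 (Pi.single ν (((k + 1 + 1 : ℕ)) : ℤ)) ≤ Real.exp (-L) * kingS2Inf m2 (Pi.single ν (((k + 1 : ℕ)) : ℤ)) := h k
        _ ≤ Real.exp (-L) * (Real.exp (-(L * (((k + 1 : ℕ) : ℝ) - 1))) * kingS2Inf m2 (Pi.single ν ((1 : ℕ) : ℤ))) :=
            mul_le_mul_of_nonneg_left ih (Real.exp_pos _).le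
        _ = _ := by
            rw [← mul_assoc, ← Real.exp_add]
            congr 2
            push_cast
            ring

/-- ★★★ **THE LATTICE EFFECTIVE MASS CONVERGES TO THE MASS**: `m_eff(t) = log(S₂^{ℝ}(te_ν)∕S₂^{ℝ}((t+1)e_ν)) → √m²` as `t → ∞` (decreasing and `≥ m`, it converges to
some `L ≥ m`; `L > m` would give `S(t) ≤ S(1)e^{−L(t−1)}` and contradict part Ϸ-j's `lim S(t)^{1∕t} = e^{−m}`). [cite: King1986, Thm 3.3 (3.6) p.655, Thm 2.1 (2.22) p.654] -/
theorem tendsto_log_kingS2Inf_ratio {m2 : ℝ} (hm : 0 < m2) (ν : Fin (d + 1)) :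
    Tendsto (fun t : ℕ => Real.log (kingS2Inf m2 (Pi.single ν ((t : ℕ) : ℤ)) / kingS2Inf m2 (Pi.single ν (((t + 1 : ℕ)) : ℤ)))) atTop
      (𝓝 (Real.sqrt m2)) := by
  -- the shifted sequence `u n = m_eff(n+1)` is antitone and bounded below by `m`
  set u : ℕ → ℝ := fun n => Real.log (kingS2Inf m2 (Pi.single ν (((n + 1 : ℕ)) : ℤ)) / kingS2Inf m2 (Pi.single ν (((n + 1 + 1 : ℕ)) : ℤ))) with hu
  have hanti : Antitone u := antitone_nat_of_succ_le fun n => log_kingS2Inf_ratio_antitone hm ν (show 1 ≤ n + 1 by omega)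
  have hlow : ∀ n, Real.sqrt m2 ≤ u n := fun n => le_log_kingS2Inf_ratio hm ν (show 1 ≤ n + 1 by omega)
  have hbdd : BddBelow (range u) := ⟨Real.sqrt m2, by rintro _ ⟨n, rfl⟩; exact hlow n⟩
  have hconv : Tendsto u atTop (𝓝 (⨅ n, u n)) := tendsto_atTop_ciInf hanti hbdd
  set L := ⨅ n, u n with hL
  have hmL : Real.sqrt m2 ≤ L := le_ciInf hlow
  have hLu : ∀ n, L ≤ u n := fun n => ciInf_le hbdd n
  -- `L ≤ m`: the ratio bound `S(s+2) ≤ e^{−L}S(s+1)` and part Ϸ-j's limit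
  have hratio : ∀ s : ℕ, kingS2Inf m2 (Pi.single ν (((s + 2 : ℕ)) : ℤ)) ≤ Real.exp (-L) * kingS2Inf m2 (Pi.single ν (((s + 1 : ℕ)) : ℤ)) := by
    intro s
    have h1 := kingS2Inf_single_pos hm ν (one_le_abs_natCast (show 1 ≤ s + 1 by omega))
    have h2 := kingS2Inf_single_pos hm ν (one_le_abs_natCast (show 1 ≤ s + 2 by omega))
    have h := hLu s
    rw [hu] at h
    simp only at h
    rw [Real.le_log_iff_exp_le (div_pos h1 h2), le_div_iff₀ h2] at h
    -- `e^{L} S(s+2) ≤ S(s+1)` ⇒ `S(s+2) ≤ e^{−L} S(s+1)`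
    have := mul_le_mul_of_nonneg_left h (Real.exp_pos (-L)).le
    rw [← mul_assoc, ← Real.exp_add, neg_add_cancel, Real.exp_zero, one_mul] at this
    simpa [add_assoc] using this
  have hLm : L ≤ Real.sqrt m2 := by
    -- root form of `S(t) ≤ e^{−L(t−1)} S(1)` versus `S(t)^{1/t} → e^{−m}`
    set S1 := kingS2Inf m2 (Pi.single ν ((1 : ℕ) : ℤ)) with hS1
    have hS1pos : 0 < S1 := kingS2Inf_single_pos hm ν (one_le_abs_natCast le_rfl)
    have hK : 0 < S1 * Real.exp L := by positivity
    have hlim := tendsto_rpow_abs_kingS2Inf_axis hm ν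
    have hup : Tendsto (fun t : ℕ => (S1 * Real.exp L) ^ ((t : ℝ)⁻¹) * Real.exp (-L)) atTop (𝓝 (Real.exp (-L))) := by
      have h : (fun t : ℕ => (S1 * Real.exp L) ^ ((t : ℝ)⁻¹)) = fun t : ℕ => Real.exp (Real.log (S1 * Real.exp L) / (t : ℝ)) := by
        funext t
        rw [Real.rpow_def_of_pos hK, div_eq_mul_inv]
      have h1 : Tendsto (fun t : ℕ => (S1 * Real.exp L) ^ ((t : ℝ)⁻¹)) atTop (𝓝 1) := by
        rw [h, ← Real.exp_zero]
        exact (Real.continuous_exp.tendsto 0).comp (tendsto_const_div_atTop_nhds_zero_nat _)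
      have := h1.mul_const (Real.exp (-L))
      rwa [one_mul] at this
    have hle : ∀ᶠ t : ℕ in atTop, |kingS2Inf m2 ((t : ℤ) • (Pi.single ν (1 : ℤ) : Fin (d + 1) → ℤ))| ^ ((t : ℝ)⁻¹)
        ≤ (S1 * Real.exp L) ^ ((t : ℝ)⁻¹) * Real.exp (-L) := by
      filter_upwards [eventually_ge_atTop 1] with t ht
      have ht0 : (0 : ℝ) < t := by exact_mod_cast ht
      have hpos := kingS2Inf_single_pos hm ν (one_le_abs_natCast ht)
      have hb := kingS2Inf_single_le_exp_of_ratio ν hratio ht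
      rw [zsmul_single_one, abs_of_pos hpos]
      have hb' : kingS2Inf m2 (Pi.single ν ((t : ℕ) : ℤ)) ≤ (S1 * Real.exp L) * Real.exp (-(L * t)) := by
        refine hb.trans (le_of_eq ?_)
        rw [hS1, mul_comm, mul_assoc, ← Real.exp_add]
        congr 2
        ring
      have hr := Real.rpow_le_rpow hpos.le hb' (inv_nonneg.mpr ht0.le)
      refine hr.trans (le_of_eq ?_)
      rw [Real.mul_rpow hK.le (Real.exp_pos _).le, ← Real.exp_mul]
      congr 2
      field_simp
    have := le_of_tendsto_of_tendsto hlim hup hle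
    -- `e^{−m} ≤ e^{−L}` ⇒ `L ≤ m`
    have := Real.exp_le_exp.mp this
    linarith
  have hLeq : L = Real.sqrt m2 := le_antisymm hLm hmL
  rw [hLeq] at hconv
  exact (tendsto_add_atTop_iff_nat 1).mp hconv

end Summit.QuantumFields.YangMills.BalabanUVNodes.N15KingModelRung.OptimalDecay
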